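import Mathlib
import Summits.AtomisticToContinuum.FouriersLaw.Theorems.EmbeddedDrudeMourreDrudeDissolutionSupBoundPointwise
import Summits.AtomisticToContinuum.FouriersLaw.Theorems.EmbeddedDrudeMourreDrudeDissolutionCutoffFamily
import HarnessLib

/-!
# The cutoff family with its sup bound (items (C5)+(C6) of stub B1b″ combined)
(crux `EmbeddedDrudeMourre.DrudeDissolution`, item stmt-AtomisticToContinuum-12593; `--supports` file for the
registered sub-goal `cutoff_sup_family` of stub B1b″ `stub_excursionSecondDifference` of line
`kinetic-polymer-gas-on-the-time-axis`; closes nothing; lead c13 (process B), 2026-08-17)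

WHAT. `cutoff_sup_family`: for the concrete data of stub B1b″ (free functions with defining hypotheses: the sine
polynomial profile `f`, `S₁, S₂, A, W`, `D = |∇Ω|²`, `Xⱼ = ∂ⱼΩ/D`), there are `K ≥ 0` and `η₀ = 1` such that for every
`0 < η ≤ η₀` some `C²` cutoff `Θ` with values in `[0,1]`, `2π`-periodic, `≡ 0` near the points where one of the
five arguments is `< η²`, `= 1` where all are `≥ 4η²`, together with the divergence `L = Σⱼ∂ⱼ(WΘXⱼ)`, satisfies
the sup bound `|Σⱼ∂ⱼ(L Xⱼ)| ≤ K/η²` everywhere — verbatim the hypothesis of the twin seat's (C8) plumbing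
`stub_excursionSecondDifference_of_supBound`.

HOW. `exists_cutoff_family` (p159253) for the standard frame and `supBound_pointwise` (item (C6)).
-/

noncomputable section

open scoped Topology
open Filter Set

namespace Summit.AtomisticToContinuum.FouriersLaw.Theorems.DrudeDissolution.KineticPolymerGasOnTheTimeAxis

open Literature.MathematicalPhysics.KineticTheory
open Literature.MathematicalPhysics.KineticTheory.PhononBoltzmann

/-- **Registered sub-goal `cutoff_sup_family` of stub B1b″ (items (C5)+(C6)).** See the module docstring.
[folklore] -/
theorem cutoff_sup_family :
    ∀ ω₂ a b : ℝ, 0 < ω₂ → ∀ (M : ℕ) (c : Fin M → ℝ) (f : ℝ → ℝ) (A S₁ S₂ W D X₁ X₂ X₃ : ℝ × ℝ × ℝ → ℝ),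
    (∀ k, f k = ∑ i, c i * Real.sin (((i : ℕ) + 1 : ℕ) * k)) →
    (∀ p : ℝ × ℝ × ℝ, S₁ p = Real.sin ((p.2.1 - p.1) / 2)) →
    (∀ p : ℝ × ℝ × ℝ, S₂ p = Real.sin ((p.2.1 - p.2.2) / 2)) →
    (∀ p : ℝ × ℝ × ℝ, A p =
      8 * ((dispersion ω₂ p.1 * dispersion ω₂ p.2.2 +
              dispersion ω₂ p.2.1 * dispersion ω₂ (p.1 + p.2.2 - p.2.1) + 2 * (ω₂ + 2)) *
            Real.cos ((p.1 + p.2.2) / 2) -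
          4 * Real.cos ((p.2.1 - p.1) / 2) * Real.cos ((p.2.2 - p.2.1) / 2)) /
        ((dispersion ω₂ p.1 + dispersion ω₂ p.2.2 + dispersion ω₂ p.2.1 + dispersion ω₂ (p.1 + p.2.2 - p.2.1)) *
          (dispersion ω₂ p.1 * dispersion ω₂ p.2.2 +
            dispersion ω₂ p.2.1 * dispersion ω₂ (p.1 + p.2.2 - p.2.1)))) →
    (∀ p : ℝ × ℝ × ℝ, W p = vertex a b p.1 p.2.2 p.2.1 ^ 2 /
        (dispersion ω₂ p.1 * dispersion ω₂ p.2.2 * dispersion ω₂ p.2.1 * dispersion ω₂ (p.1 + p.2.2 - p.2.1)) ^ 2 *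
      (f p.1 + f p.2.2 - f p.2.1 - f (p.1 + p.2.2 - p.2.1)) ^ 2) →
    (∀ q, D q = (fderiv ℝ (fun r : ℝ × ℝ × ℝ => resonanceFn ω₂ r.1 r.2.2 r.2.1) q (1, 0, 0)) ^ 2 +
      (fderiv ℝ (fun r : ℝ × ℝ × ℝ => resonanceFn ω₂ r.1 r.2.2 r.2.1) q (0, 1, 0)) ^ 2 +
      (fderiv ℝ (fun r : ℝ × ℝ × ℝ => resonanceFn ω₂ r.1 r.2.2 r.2.1) q (0, 0, 1)) ^ 2) →
    (∀ q, X₁ q = fderiv ℝ (fun r : ℝ × ℝ × ℝ => resonanceFn ω₂ r.1 r.2.2 r.2.1) q (1, 0, 0) / D q) →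
    (∀ q, X₂ q = fderiv ℝ (fun r : ℝ × ℝ × ℝ => resonanceFn ω₂ r.1 r.2.2 r.2.1) q (0, 1, 0) / D q) →
    (∀ q, X₃ q = fderiv ℝ (fun r : ℝ × ℝ × ℝ => resonanceFn ω₂ r.1 r.2.2 r.2.1) q (0, 0, 1) / D q) →
    (∃ K η₀ : ℝ, 0 ≤ K ∧ 0 < η₀ ∧ η₀ ≤ 1 ∧ ∀ η : ℝ, 0 < η → η ≤ η₀ → ∃ Θ LG : ℝ × ℝ × ℝ → ℝ,
      ContDiff ℝ 2 Θ ∧ (∀ p, 0 ≤ Θ p ∧ Θ p ≤ 1) ∧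
      (∀ q : ℝ × ℝ × ℝ, Θ (q + (2 * Real.pi, 0, 0)) = Θ q) ∧ (∀ q : ℝ × ℝ × ℝ, Θ (q + (0, 2 * Real.pi, 0)) = Θ q) ∧
      (∀ q : ℝ × ℝ × ℝ, Θ (q + (0, 0, 2 * Real.pi)) = Θ q) ∧
      (∀ p : ℝ × ℝ × ℝ, (S₁ p ^ 2 + A p ^ 2 < η ^ 2 ∨ S₂ p ^ 2 + A p ^ 2 < η ^ 2 ∨ S₁ p ^ 2 + S₂ p ^ 2 < η ^ 2 ∨
          (1 - Real.cos p.1) + (1 - Real.cos p.2.2) + (1 + Real.cos p.2.1) < η ^ 2 ∨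
          (1 + Real.cos p.1) + (1 + Real.cos p.2.2) + (1 - Real.cos p.2.1) < η ^ 2) → Θ =ᶠ[𝓝 p] 0) ∧
      (∀ p : ℝ × ℝ × ℝ, 4 * η ^ 2 ≤ S₁ p ^ 2 + A p ^ 2 → 4 * η ^ 2 ≤ S₂ p ^ 2 + A p ^ 2 →
          4 * η ^ 2 ≤ S₁ p ^ 2 + S₂ p ^ 2 →
          4 * η ^ 2 ≤ (1 - Real.cos p.1) + (1 - Real.cos p.2.2) + (1 + Real.cos p.2.1) →
          4 * η ^ 2 ≤ (1 + Real.cos p.1) + (1 + Real.cos p.2.2) + (1 - Real.cos p.2.1) → Θ p = 1) ∧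
      (∀ q, LG q = fderiv ℝ (fun r => W r * Θ r * X₁ r) q (1, 0, 0) +
        fderiv ℝ (fun r => W r * Θ r * X₂ r) q (0, 1, 0) + fderiv ℝ (fun r => W r * Θ r * X₃ r) q (0, 0, 1)) ∧
      (∀ p, |fderiv ℝ (fun q => LG q * X₁ q) p (1, 0, 0) + fderiv ℝ (fun q => LG q * X₂ q) p (0, 1, 0) +
        fderiv ℝ (fun q => LG q * X₃ q) p (0, 0, 1)| ≤ K / η ^ 2)) := by
  intro ω₂ a b hω M c f A S₁ S₂ W D X₁ X₂ X₃ hf hS₁ hS₂ hA hW hD hX₁ hX₂ hX₃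
  obtain ⟨aΘ, bΘ, haΘ, hbΘ, hfam⟩ := exists_cutoff_family ω₂ hω A S₁ S₂ hS₁ hS₂ hA
    (![((1 : ℝ), (0 : ℝ), (0 : ℝ)), (0, 1, 0), (0, 0, 1)] : Fin 3 → ℝ × ℝ × ℝ) stdFrame_admissible
  obtain ⟨K, hK, hsup⟩ := supBound_pointwise ω₂ a b hω M c f A S₁ S₂ W D X₁ X₂ X₃ hf hS₁ hS₂ hA hW hD hX₁ hX₂ hX₃
    aΘ bΘ haΘ hbΘ
  refine ⟨K, 1, hK, one_pos, le_rfl, fun η hη hη1 => ?_⟩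
  obtain ⟨Θ, hΘC, hΘ01, P1, P2, P3, hvan, hone, hΘd⟩ := hfam η hη
  refine ⟨Θ, fun q => fderiv ℝ (fun r => W r * Θ r * X₁ r) q (1, 0, 0) +
      fderiv ℝ (fun r => W r * Θ r * X₂ r) q (0, 1, 0) + fderiv ℝ (fun r => W r * Θ r * X₃ r) q (0, 0, 1),
    hΘC, hΘ01, P1, P2, P3, hvan, hone, fun q => rfl, ?_⟩
  exact hsup η hη hη1 Θ _ hΘC hΘ01 hvan hΘd (fun q => rfl)

end Summit.AtomisticToContinuum.FouriersLaw.Theorems.DrudeDissolution.KineticPolymerGasOnTheTimeAxis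

end
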